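import Literature.Analysis.FunctionSpaces.TorusSobolevInterpolationCS
import HarnessLib

/-!
# Sobolev interpolation on `T³` by Cauchy–Schwarz in Fourier variables (tools stub `stub_torusInterpolationTools`,
# block N-R, line `ergodic-budget-selection-closing`, crux `BaireTransfer.DenseLoudDesignerForces`,
# stmt-AnomalousDissipation-1143)

Summit-side specialisation to `T³ = UnitAddTorus (Fin 3)` of the Literature interpolation inequalities
`Torus.integral_norm_laplacian_sq_le_sqrt_mul_sqrt`, `Torus.gradNormSq_laplacian_le_sqrt_integral_mul_sqrt_integral`,
`Torus.gradNormSq_laplacian_le_sqrt_gradNormSq_mul_sqrt_gradNormSq`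
(`Literature/Analysis/FunctionSpaces/TorusSobolevInterpolationCS.lean`): for a smooth field `w` on `T³`,

  `‖Δw‖₂² ≤ ‖∇w‖₂ ‖∇Δw‖₂`, `‖∇Δw‖₂² ≤ ‖Δw‖₂ ‖Δ²w‖₂`, `‖∇Δw‖₂² ≤ ‖∇w‖₂ ‖∇Δ²w‖₂`

(`‖∇·‖₂² = Torus.gradNormSq`). Mechanism: Parseval reads `‖∇w‖₂², ‖Δw‖₂², ‖∇Δw‖₂², ‖Δ²w‖₂², ‖∇Δ²w‖₂²` as the
spectral moments `∑ₖ a^j ‖ŵ(k)‖²`, `a = 4π²|k|²`, `j = 1, …, 5` (Grafakos 2014, Prop. 3.2.6 (8), 3.2.7 (3)), and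
`∑ a^s‖ŵ‖² ≤ (∑ a^{s-r}‖ŵ‖²)^{1/2} (∑ a^{s+r}‖ŵ‖²)^{1/2}` is the Cauchy–Schwarz inequality. On a set with uniform
high Sobolev (e.g. Gevrey) bounds these make the `H³` distance HÖLDER-controlled by the `H¹` distance — the
mechanism by which the Navier–Stokes vector field becomes continuous in the model norm along the Gevrey tube of
the smooth-model construction. The registered tools stub `stub_torusInterpolationTools` is proved BY NAME with
exactly the registered signature.

References: L. Grafakos, *Classical Fourier Analysis* (3rd ed., 2014) Props. 3.2.6, 3.2.7; P. Constantin,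
C. Foias, *Navier–Stokes Equations* (1988), Ch. 4.
-/

-- `Summit.<Summit>.<Problem>` is the tree's mandated summit-side namespace (CONVENTIONS §2); for this
-- single-conjunct summit the two coincide, so the duplicate is deliberate.
set_option linter.dupNamespace false

noncomputable section

open scoped BigOperators Topology ENNReal InnerProductSpace
open Filter Set Function MeasureTheory

namespace Summit.AnomalousDissipation.AnomalousDissipation.Theorems.DenseLoudDesignerForces.Ergodic

open Literature.Analysis.FunctionSpaces Literature.Analysis.FunctionSpaces.Torus
open Literature.Analysis.FluidPDE

/-- **Tools stub T2 of block N-R (`stub_torusInterpolationTools`, crux stmt-AnomalousDissipation-1143, line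
`ergodic-budget-selection-closing`) — Sobolev interpolation on the torus by Cauchy–Schwarz in Fourier
variables.**  For a smooth field `w` on `T³`: `‖Δw‖₂² ≤ ‖∇w‖₂ ‖∇Δw‖₂`, `‖∇Δw‖₂² ≤ ‖Δw‖₂ ‖Δ²w‖₂` and
`‖∇Δw‖₂² ≤ ‖∇w‖₂ ‖∇Δ²w‖₂` (Parseval: `∑ a^s‖ŵ‖² ≤ (∑ a^{s−r}‖ŵ‖²)^{1/2}(∑ a^{s+r}‖ŵ‖²)^{1/2}`, `a = 4π²|k|²`,
Cauchy–Schwarz; the three Literature inequalities `Torus.integral_norm_laplacian_sq_le_sqrt_mul_sqrt`,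
`Torus.gradNormSq_laplacian_le_sqrt_integral_mul_sqrt_integral`,
`Torus.gradNormSq_laplacian_le_sqrt_gradNormSq_mul_sqrt_gradNormSq` at `d = Fin 3`). [folklore] -/
theorem stub_torusInterpolationTools :
    ∀ (w : (UnitAddTorus (Fin 3)) → (EuclideanSpace ℝ (Fin 3))), IsSmooth w →
      (∫ x, ‖laplacian w x‖ ^ 2) ≤ Real.sqrt (gradNormSq w) * Real.sqrt (gradNormSq (laplacian w)) ∧
      gradNormSq (laplacian w) ≤ Real.sqrt (∫ x, ‖laplacian w x‖ ^ 2) * Real.sqrt (∫ x, ‖laplacian (laplacian w) x‖ ^ 2) ∧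
      gradNormSq (laplacian w) ≤ Real.sqrt (gradNormSq w) * Real.sqrt (gradNormSq (laplacian (laplacian w))) :=
  fun _ hw => ⟨integral_norm_laplacian_sq_le_sqrt_mul_sqrt hw,
    gradNormSq_laplacian_le_sqrt_integral_mul_sqrt_integral hw,
    gradNormSq_laplacian_le_sqrt_gradNormSq_mul_sqrt_gradNormSq hw⟩

end Summit.AnomalousDissipation.AnomalousDissipation.Theorems.DenseLoudDesignerForces.Ergodic

end
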